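import Mathlib.Analysis.Calculus.TaylorIntegral
import Mathlib.Analysis.Asymptotics.Lemmas
import Literature.Analysis.FunctionSpaces.ContDiffHolderComposition
import Literature.Analysis.FunctionSpaces.ContDiffHolderFDerivCLM
import Literature.Analysis.FunctionSpaces.SmoothParametricIntegral
import HarnessLib

/-!
# The Nemytskii operator `u ↦ φ ∘ u` is smooth on `C^{k,r}_b` (Hölder spaces, part 26)

Topic `Literature/Analysis/FunctionSpaces`. On the Banach spaces `C^{k,r}_b(E, F)` of part 3
(`ContDiffHolderFunction`, `0 ≤ r ≤ 1`) the **superposition (Nemytskii) operator**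
`N_φ : u ↦ φ ∘ u` of part 6 (`ContDiffHolderFunction.compLeft`; `φ : F → G` smooth, `F`
finite-dimensional, `G` complete) is `C^∞` as a map of Banach spaces
`C^{k,r}_b(E, F) → C^{k,r}_b(E, G)`, with Fréchet derivative `h ↦ (Dφ ∘ u) · h`
(`ContDiffHolderFunction.contDiff_compLeft`, `hasFDerivAt_compLeft`). This is the standard
smoothness of superposition operators on Hölder-type Banach algebras (Gilbarg–Trudinger 2001,
§4.1 and Ch. 17, where the coefficients `F(x, u, Du, D²u)` are composed with Hölder functions;
the `C¹` case for `φ = exp` is part 8, `ContDiffHolderExp.lean`).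

Proof.
* **Local bounds** (`exists_norm_compLeft_le`): `‖ψ ∘ w‖_{k,r} ≤ M(ψ, R)` for `‖w‖_{k,r} ≤ R`, by
  the induction of part 6 made quantitative (`k = 0`: `ψ` is bounded and Lipschitz on the
  compact ball of radius `R`; `k → k+1`: `‖ψ ∘ w‖_{k+1,r} = ‖ψ ∘ w‖_∞ + ‖(Dψ ∘ w) ∘L Dw‖_{k,r}` and
  the Leibniz bound of part 5).
* **Taylor's formula with smooth remainder**: `φ(a + b) − φ(a) − Dφ(a) b = Q_φ(a, b)(b, b)` with
  `Q_φ(a, b) = ∫₀¹ (1 − t) D²φ(a + t b) dt` (Mathlib's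
  `map_add_eq_sum_add_integral_iteratedFDeriv`), and `Q_φ` is smooth on `F × F` (differentiation
  under the integral sign, `contDiff_parametric_intervalIntegral`).
* **Derivative** (`hasFDerivAt_compLeft`): hence
  `N_φ(u + h) − N_φ(u) − (Dφ ∘ u) h = (Q_φ ∘ (u, h)) (h, h)` in `C^{k,r}_b`, of norm
  `≤ C_k² ‖Q_φ ∘ (u, h)‖_{k,r} ‖h‖² = O(‖h‖²)` by the Leibniz bound and the local bound.
* **Smoothness**: the derivative `u ↦ (A ↦ (Dφ ∘ u) · A)` is the bounded linear pairing
  `bilinearCLM` composed with the Nemytskii operator of `Dφ : F → (F →L G)`; induction on the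
  order of differentiability, for all targets `G` and all smooth `φ` at once.

Everything is proved; no named facts. All spaces live in one universe (the Leibniz estimate of
part 5 is so stated).

## References

* D. Gilbarg, N. S. Trudinger, *Elliptic Partial Differential Equations of Second Order* (2001),
  §4.1, Ch. 17. [GilbargTrudinger2001]
-/

noncomputable section

open Set Filter Metric Asymptotics Topology
open scoped NNReal ENNReal ContDiff

universe u

-- spaces of iterated continuous linear maps (`F →L F →L G`, …) need a deeper instance search,
-- as in `ContDiffHolderLeibniz.lean`
set_option maxSynthPendingDepth 3

namespace Literature.Analysis.FunctionSpaces

/-! ### Taylor's formula of order two with a smooth remainder -/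

section Taylor

variable {F G : Type*} [NormedAddCommGroup F] [NormedSpace ℝ F] [NormedAddCommGroup G]
  [NormedSpace ℝ G]

/-- The integral Taylor remainder of order two `Q_φ(a, b) = ∫₀¹ (1 − t) D²φ(a + t b) dt`, as a
function of the pair `(a, b) ∈ F × F` with values in `F →L F →L G`, is smooth for smooth `φ`
(`F` finite-dimensional; differentiation under the integral sign). [folklore] -/
theorem contDiff_taylorRemTwo [FiniteDimensional ℝ F] {φ : F → G} (hφ : ContDiff ℝ ∞ φ) :
    ContDiff ℝ ∞ fun p : F × F =>
      ∫ t in (0 : ℝ)..1, (1 - t) • fderiv ℝ (fderiv ℝ φ) (p.1 + t • p.2) := by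
  have hD2 : ContDiff ℝ ∞ (fderiv ℝ (fderiv ℝ φ)) :=
    (hφ.fderiv_right (m := ∞) le_rfl).fderiv_right (m := ∞) le_rfl
  have hH : ContDiff ℝ ∞ fun q : ℝ × (F × F) =>
      (1 - q.1) • fderiv ℝ (fderiv ℝ φ) (q.2.1 + q.1 • q.2.2) :=
    (contDiff_const.sub contDiff_fst).smul
      (hD2.comp (contDiff_snd.fst.add (contDiff_fst.smul contDiff_snd.snd)))
  exact contDiff_parametric_intervalIntegral hH 0 1

/-- **Taylor's formula of order two with integral remainder**:
`φ(a + b) − φ(a) − Dφ(a) b = (∫₀¹ (1 − t) D²φ(a + t b) dt)(b, b)` for smooth `φ` with complete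
target (Mathlib's `map_add_eq_sum_add_integral_iteratedFDeriv`, the evaluation at `(b, b)` taken
out of the integral). [folklore] -/
theorem taylor_two_eq_integral_apply [CompleteSpace G] {φ : F → G} (hφ : ContDiff ℝ ∞ φ)
    (a b : F) : φ (a + b) - φ a - fderiv ℝ φ a b =
      (∫ t in (0 : ℝ)..1, (1 - t) • fderiv ℝ (fderiv ℝ φ) (a + t • b)) b b := by
  have hD2 : ContDiff ℝ ∞ (fderiv ℝ (fderiv ℝ φ)) :=
    (hφ.fderiv_right (m := ∞) le_rfl).fderiv_right (m := ∞) le_rfl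
  have hc : Continuous fun t : ℝ => (1 - t) • fderiv ℝ (fderiv ℝ φ) (a + t • b) :=
    (continuous_const.sub continuous_id).smul
      (hD2.continuous.comp (continuous_const.add (continuous_id.smul continuous_const)))
  have hc' : Continuous fun t : ℝ => ((1 - t) • fderiv ℝ (fderiv ℝ φ) (a + t • b)) b :=
    (ContinuousLinearMap.apply ℝ (F →L[ℝ] G) b).continuous.comp hc
  have h := map_add_eq_sum_add_integral_iteratedFDeriv (n := 1) (f := φ) (x := a) (y := b)
    (fun t _ => (contDiff_infty.1 hφ (1 + 1)).contDiffAt)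
  simp only [Finset.sum_range_succ, Finset.sum_range_zero, zero_add, Nat.factorial_zero,
    Nat.factorial_one, Nat.cast_one, inv_one, one_smul, pow_one, iteratedFDeriv_zero_apply,
    iteratedFDeriv_one_apply, Nat.reduceAdd, iteratedFDeriv_two_apply] at h
  rw [ContinuousLinearMap.intervalIntegral_apply (hc.intervalIntegrable _ _),
    ContinuousLinearMap.intervalIntegral_apply (hc'.intervalIntegrable _ _)]
  simp only [smul_apply]
  rw [h]
  abel

end Taylor

/-! ### Pairs in `C^{k,r}_b` -/

section Pairs

variable {E F F' : Type*} [NormedAddCommGroup E] [NormedSpace ℝ E] [NormedAddCommGroup F]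
  [NormedSpace ℝ F] [NormedAddCommGroup F'] [NormedSpace ℝ F'] {k : ℕ} {r : ℝ≥0}

/-- **Pairs**: `u ∈ C^{k,r}_b(E, F)`, `v ∈ C^{k,r}_b(E, F')` give `(u, v) ∈ C^{k,r}_b(E, F × F')`
(`(u, v) = inl ∘ u + inr ∘ v`). [folklore] -/
theorem MemContDiffHolder.prodMk {u : E → F}
    {v : E → F'} (hu : MemContDiffHolder k r u) (hv : MemContDiffHolder k r v) :
    MemContDiffHolder k r fun x => (u x, v x) := by
  have h := (hu.clm_comp (ContinuousLinearMap.inl ℝ F F')).add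
    (hv.clm_comp (ContinuousLinearMap.inr ℝ F F'))
  convert h using 1
  funext x
  simp

namespace ContDiffHolderFunction

/-- `‖L ∘ u‖_{k,r} ≤ ‖L‖ ‖u‖_{k,r}` for a continuous linear `L` (bundled form of
`eContDiffHolderNorm_clm_comp_le`). [folklore] -/
theorem norm_clmComp_le (L : F →L[ℝ] F') (u : ContDiffHolderFunction E F k r) :
    ‖(⟨fun x => L (u x), u.memContDiffHolder.clm_comp L⟩ : ContDiffHolderFunction E F' k r)‖ ≤
      ‖L‖ * ‖u‖ := by
  rw [← ENNReal.ofReal_le_ofReal_iff (by positivity), ofReal_norm_eq,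
    ENNReal.ofReal_mul (norm_nonneg _), ofReal_norm, ofReal_norm_eq]
  exact eContDiffHolderNorm_clm_comp_le L u.contDiff r

/-- `‖(u, v)‖_{k,r} ≤ ‖u‖_{k,r} + ‖v‖_{k,r}`. [folklore] -/
theorem norm_prodMk_le (u : ContDiffHolderFunction E F k r) (v : ContDiffHolderFunction E F' k r) :
    ‖(⟨fun x => (u x, v x), u.memContDiffHolder.prodMk v.memContDiffHolder⟩ :
      ContDiffHolderFunction E (F × F') k r)‖ ≤ ‖u‖ + ‖v‖ := by
  have heq : (⟨fun x => (u x, v x), u.memContDiffHolder.prodMk v.memContDiffHolder⟩ :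
      ContDiffHolderFunction E (F × F') k r) =
      (⟨fun x => ContinuousLinearMap.inl ℝ F F' (u x),
        u.memContDiffHolder.clm_comp (ContinuousLinearMap.inl ℝ F F')⟩ :
          ContDiffHolderFunction E (F × F') k r) +
      ⟨fun x => ContinuousLinearMap.inr ℝ F F' (v x),
        v.memContDiffHolder.clm_comp (ContinuousLinearMap.inr ℝ F F')⟩ :=
    ContDiffHolderFunction.ext fun x => by simp
  rw [heq]
  refine (norm_add_le _ _).trans (add_le_add ?_ ?_)
  · exact (norm_clmComp_le _ u).trans
      (mul_le_of_le_one_left (norm_nonneg _) (ContinuousLinearMap.norm_inl_le_one ℝ F F'))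
  · exact (norm_clmComp_le _ v).trans
      (mul_le_of_le_one_left (norm_nonneg _) (ContinuousLinearMap.norm_inr_le_one ℝ F F'))

end ContDiffHolderFunction

end Pairs

/-! ### Local bounds and differentiability of the Nemytskii operator -/

namespace ContDiffHolderFunction

section Nemytskii

variable {E F : Type u} [NormedAddCommGroup E] [NormedSpace ℝ E] [NormedAddCommGroup F]
  [NormedSpace ℝ F] [FiniteDimensional ℝ F] {r : ℝ≥0}

/-- **Local boundedness of the Nemytskii operator**: for `φ ∈ C^{k+1}(F, G)` (`F`
finite-dimensional) and every radius `R` there is `M ≥ 0` with `‖φ ∘ u‖_{k,r} ≤ M` whenever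
`‖u‖_{k,r} ≤ R`. Induction on `k` as in part 6: for `k = 0`, `φ` is bounded and Lipschitz on the
compact ball of radius `R` containing the range of `u`; for `k → k + 1`,
`‖φ ∘ u‖_{k+1,r} = ‖φ ∘ u‖_∞ + ‖(Dφ ∘ u) ∘L Du‖_{k,r}` with `‖u‖_{k,r} ≤ 3‖u‖_{k+1,r}`,
`‖Du‖_{k,r} ≤ ‖u‖_{k+1,r}` and the Leibniz bound. [folklore] -/
theorem exists_norm_compLeft_le (hr : r ≤ 1) :
    ∀ {k : ℕ} {G : Type u} [NormedAddCommGroup G] [NormedSpace ℝ G] {φ : F → G}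
      (hφ : ContDiff ℝ (k + 1) φ) (R : ℝ), ∃ M : ℝ, 0 ≤ M ∧
        ∀ u : ContDiffHolderFunction E F k r, ‖u‖ ≤ R → ‖compLeft hr φ hφ u‖ ≤ M := by
  intro k
  induction k with
  | zero =>
    intro G _ _ φ hφ R
    have hK : IsCompact (closedBall (0 : F) R) := isCompact_closedBall 0 R
    obtain ⟨C, hC⟩ := hK.exists_bound_of_continuousOn hφ.continuous.continuousOn
    obtain ⟨L, hL⟩ :=
      hK.exists_bound_of_continuousOn (hφ.continuous_fderiv one_ne_zero).continuousOn
    set L' : ℝ≥0 := ⟨max L 0, le_max_right _ _⟩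
    have hLip : LipschitzOnWith L' φ (closedBall (0 : F) R) := by
      refine (convex_closedBall (0 : F) R).lipschitzOnWith_of_nnnorm_fderiv_le
        (fun x _ => (hφ.differentiable one_ne_zero x)) fun x hx => ?_
      rw [← NNReal.coe_le_coe, coe_nnnorm]
      exact (hL x hx).trans (le_max_left _ _)
    refine ⟨max C 0 + max L 0 * max R 0, by positivity, fun u hu => ?_⟩
    have hmem : ∀ x, u x ∈ closedBall (0 : F) R := fun x =>
      mem_closedBall_zero_iff.2 ((u.norm_apply_le_norm x).trans hu)
    rw [norm_def, Finset.sum_range_one]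
    refine add_le_add ?_ ?_
    · refine supNormDeriv_le _ 0 (le_max_of_le_right le_rfl) fun x => ?_
      rw [norm_iteratedFDeriv_zero, compLeft_apply]
      exact (hC (u x) (hmem x)).trans (le_max_left _ _)
    · have hH : HolderWith (nnHolderNorm r (iteratedFDeriv ℝ 0 (u : E → F))) r (u : E → F) :=
        holderWith_iteratedFDeriv_zero_iff.1 u.memHolder.holderWith
      have hH' : HolderWith (L' * nnHolderNorm r (iteratedFDeriv ℝ 0 (u : E → F))) r
          (iteratedFDeriv ℝ 0 ((compLeft hr φ hφ u : ContDiffHolderFunction E G 0 r) : E → G)) := by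
        refine holderWith_iteratedFDeriv_zero_iff.2 fun x y => ?_
        calc edist (φ (u x)) (φ (u y)) ≤ (L' : ℝ≥0∞) * edist (u x) (u y) :=
              hLip (hmem x) (hmem y)
          _ ≤ (L' : ℝ≥0∞) * ((nnHolderNorm r (iteratedFDeriv ℝ 0 (u : E → F)) : ℝ≥0∞) *
                edist x y ^ (r : ℝ)) := mul_le_mul' le_rfl (hH x y)
          _ = ((L' * nnHolderNorm r (iteratedFDeriv ℝ 0 (u : E → F)) : ℝ≥0) : ℝ≥0∞) *
                edist x y ^ (r : ℝ) := by rw [ENNReal.coe_mul, mul_assoc]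
      have h1 : ((nnHolderNorm r (iteratedFDeriv ℝ 0
          ((compLeft hr φ hφ u : ContDiffHolderFunction E G 0 r) : E → G)) : ℝ≥0) : ℝ) ≤
          (L' : ℝ) * nnHolderNorm r (iteratedFDeriv ℝ 0 (u : E → F)) := by
        exact_mod_cast hH'.nnholderNorm_le
      have h2 : ((nnHolderNorm r (iteratedFDeriv ℝ 0 (u : E → F)) : ℝ≥0) : ℝ) ≤ max R 0 :=
        (u.nnHolderNorm_le_norm.trans hu).trans (le_max_left _ _)
      have h3 : (L' : ℝ) = max L 0 := rfl
      calc ((nnHolderNorm r (iteratedFDeriv ℝ 0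
            ((compLeft hr φ hφ u : ContDiffHolderFunction E G 0 r) : E → G)) : ℝ≥0) : ℝ)
          ≤ (L' : ℝ) * nnHolderNorm r (iteratedFDeriv ℝ 0 (u : E → F)) := h1
        _ ≤ max L 0 * max R 0 := by
          rw [h3]
          exact mul_le_mul_of_nonneg_left h2 (le_max_right _ _)
  | succ k ih =>
    intro G _ _ φ hφ R
    have hDφ : ContDiff ℝ (k + 1) (fderiv ℝ φ) := hφ.fderiv_right (m := k + 1) (by norm_cast)
    obtain ⟨M', hM'0, hM'⟩ := ih hDφ (3 * R)
    obtain ⟨C, hC⟩ := (isCompact_closedBall (0 : F) R).exists_bound_of_continuousOn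
      hφ.continuous.continuousOn
    obtain ⟨K, hK0, hKdef⟩ : ∃ K : ℝ, 0 ≤ K ∧
        K = (k + 1) * 9 ^ k * ‖ContinuousLinearMap.compL ℝ E F G‖ :=
      ⟨_, by positivity, rfl⟩
    refine ⟨max C 0 + K * M' * max R 0, by positivity, fun u hu => ?_⟩
    -- the lower-order copy of `u` and its derivative
    set v : ContDiffHolderFunction E F k r := ⟨u, u.memContDiffHolder.of_succ hr⟩
    have hvn : ‖v‖ ≤ 3 * R := by
      have h1 : ENNReal.ofReal ‖v‖ ≤ ENNReal.ofReal (3 * ‖u‖) := by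
        rw [ofReal_norm_eq, ENNReal.ofReal_mul (by norm_num), ofReal_norm_eq,
          ENNReal.ofReal_ofNat]
        exact eContDiffHolderNorm_le_three_mul_succ u.contDiff hr r
      have h2 := (ENNReal.ofReal_le_ofReal_iff (by positivity)).1 h1
      linarith
    set w : ContDiffHolderFunction E (E →L[ℝ] F) k r :=
      ⟨fderiv ℝ (u : E → F), u.memContDiffHolder.fderiv⟩
    have hwn : ‖w‖ ≤ max R 0 := by
      have h1 : ENNReal.ofReal ‖w‖ ≤ ENNReal.ofReal ‖u‖ := by
        rw [ofReal_norm_eq, ofReal_norm_eq]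
        exact eContDiffHolderNorm_fderiv_le k r (u : E → F)
      exact (((ENNReal.ofReal_le_ofReal_iff (norm_nonneg _)).1 h1).trans hu).trans
        (le_max_left _ _)
    -- the derivative of `φ ∘ u` is the pairing `compL` of `Dφ ∘ u` and `Du`
    set D : ContDiffHolderFunction E (E →L[ℝ] G) k r :=
      bilinear hr (ContinuousLinearMap.compL ℝ E F G) (compLeft hr (fderiv ℝ φ) hDφ v) w with hD
    have hDn : ‖D‖ ≤ K * M' * max R 0 := by
      calc ‖D‖ ≤ K * ‖compLeft hr (fderiv ℝ φ) hDφ v‖ * ‖w‖ := by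
            rw [hKdef]
            exact norm_bilinear_le hr _ _ _
        _ ≤ K * M' * max R 0 :=
            mul_le_mul (mul_le_mul_of_nonneg_left (hM' v hvn) hK0) hwn (norm_nonneg _)
              (mul_nonneg hK0 hM'0)
    have hchain : fderiv ℝ ((compLeft hr φ hφ u : ContDiffHolderFunction E G (k + 1) r) : E → G) =
        (D : E → E →L[ℝ] G) := by
      funext x
      have h1 : D x = (fderiv ℝ φ (u x)).comp (fderiv ℝ (u : E → F) x) := rfl
      rw [h1]
      exact fderiv_comp x (hφ.differentiable (by simp) (u x))
        (u.contDiff.differentiable (by simp) x)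
    -- the sup norm of `φ ∘ u`
    have hsup : eSupNorm ((compLeft hr φ hφ u : ContDiffHolderFunction E G (k + 1) r) : E → G) ≤
        ENNReal.ofReal (max C 0) := by
      refine iSup_le fun x => ?_
      rw [← ofReal_norm]
      exact ENNReal.ofReal_le_ofReal ((hC (u x) (mem_closedBall_zero_iff.2
        ((u.norm_apply_le_norm x).trans hu))).trans (le_max_left _ _))
    have h1 : ENNReal.ofReal ‖compLeft hr φ hφ u‖ ≤
        ENNReal.ofReal (max C 0 + K * M' * max R 0) := by
      rw [ofReal_norm_eq, eContDiffHolderNorm_succ_eq_fderiv, hchain, ← ofReal_norm_eq,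
        ENNReal.ofReal_add (by positivity) (by positivity)]
      exact add_le_add hsup (ENNReal.ofReal_le_ofReal hDn)
    exact (ENNReal.ofReal_le_ofReal_iff (by positivity)).1 h1

/-- **The Nemytskii operator is Fréchet differentiable**: for smooth `φ : F → G` (`F`
finite-dimensional, `G` complete), `u ↦ φ ∘ u` on `C^{k,r}_b(E, F)` has derivative
`h ↦ (Dφ ∘ u) · h` at every `u`, the remainder `(Q_φ ∘ (u, h))(h, h)` being `O(‖h‖²)` in
`C^{k,r}_b` by the Leibniz bound and the local bound for `Q_φ`.
[cite: GilbargTrudinger2001, §4.1] -/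
theorem hasFDerivAt_compLeft (hr : r ≤ 1) {k : ℕ} {G : Type u} [NormedAddCommGroup G]
    [NormedSpace ℝ G] [CompleteSpace G] (φ : F → G) (hφ : ContDiff ℝ ∞ φ)
    (u : ContDiffHolderFunction E F k r) :
    HasFDerivAt (fun u : ContDiffHolderFunction E F k r =>
        compLeft hr φ (hφ.of_le (by exact_mod_cast le_top)) u)
      (bilinearCLM hr (ContinuousLinearMap.id ℝ (F →L[ℝ] G))
        (compLeft hr (fderiv ℝ φ)
          ((hφ.fderiv_right (m := ∞) le_rfl).of_le (by exact_mod_cast le_top)) u)) u := by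
  have hφk : ContDiff ℝ (k + 1) φ := hφ.of_le (by exact_mod_cast le_top)
  have hDφk : ContDiff ℝ (k + 1) (fderiv ℝ φ) :=
    (hφ.fderiv_right (m := ∞) le_rfl).of_le (by exact_mod_cast le_top)
  -- the smooth Taylor remainder `Q_φ` and the pair `(u, h)`
  set Q : F × F → F →L[ℝ] F →L[ℝ] G := fun p =>
    ∫ t in (0 : ℝ)..1, (1 - t) • fderiv ℝ (fderiv ℝ φ) (p.1 + t • p.2) with hQdef
  have hQ : ContDiff ℝ (k + 1) Q := (contDiff_taylorRemTwo hφ).of_le (by exact_mod_cast le_top)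
  have P : ∀ h : ContDiffHolderFunction E F k r, MemContDiffHolder k r fun x => (u x, h x) :=
    fun h => u.memContDiffHolder.prodMk h.memContDiffHolder
  show HasFDerivAt (fun u : ContDiffHolderFunction E F k r => compLeft hr φ hφk u)
    (bilinearCLM hr (ContinuousLinearMap.id ℝ (F →L[ℝ] G)) (compLeft hr (fderiv ℝ φ) hDφk u)) u
  obtain ⟨M, hM0, hM⟩ := exists_norm_compLeft_le (E := E) hr hQ (‖u‖ + 1)
  obtain ⟨K₁, hK₁0, hK₁⟩ : ∃ K : ℝ, 0 ≤ K ∧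
      K = (k + 1) * 9 ^ k * ‖ContinuousLinearMap.id ℝ (F →L[ℝ] G)‖ := ⟨_, by positivity, rfl⟩
  obtain ⟨K₂, hK₂0, hK₂⟩ : ∃ K : ℝ, 0 ≤ K ∧
      K = (k + 1) * 9 ^ k * ‖ContinuousLinearMap.id ℝ (F →L[ℝ] F →L[ℝ] G)‖ :=
    ⟨_, by positivity, rfl⟩
  rw [hasFDerivAt_iff_isLittleO_nhds_zero]
  have hbig : (fun h : ContDiffHolderFunction E F k r => compLeft hr φ hφk (u + h) -
      compLeft hr φ hφk u - bilinearCLM hr (ContinuousLinearMap.id ℝ (F →L[ℝ] G))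
        (compLeft hr (fderiv ℝ φ) hDφk u) h) =O[𝓝 0] fun h => ‖h‖ ^ 2 := by
    refine IsBigO.of_bound (K₁ * (K₂ * M)) ?_
    filter_upwards [Metric.ball_mem_nhds (0 : ContDiffHolderFunction E F k r) one_pos] with h hh
    rw [Metric.mem_ball, dist_zero_right] at hh
    have hrem : compLeft hr φ hφk (u + h) - compLeft hr φ hφk u -
        bilinearCLM hr (ContinuousLinearMap.id ℝ (F →L[ℝ] G)) (compLeft hr (fderiv ℝ φ) hDφk u) h =
        bilinear hr (ContinuousLinearMap.id ℝ (F →L[ℝ] G))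
          (bilinear hr (ContinuousLinearMap.id ℝ (F →L[ℝ] F →L[ℝ] G))
            (compLeft hr Q hQ ⟨fun x => (u x, h x), P h⟩) h) h := by
      ext x
      simp only [coe_sub, Pi.sub_apply, compLeft_apply, coe_add, Pi.add_apply, bilinearCLM_apply,
        bilinear_apply, ContinuousLinearMap.id_apply, coe_mk, hQdef]
      exact taylor_two_eq_integral_apply hφ (u x) (h x)
    have hprod : ‖(⟨fun x => (u x, h x), P h⟩ : ContDiffHolderFunction E (F × F) k r)‖ ≤
        ‖u‖ + 1 := (norm_prodMk_le u h).trans (by linarith [hh.le])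
    rw [hrem, Real.norm_of_nonneg (by positivity)]
    calc ‖bilinear hr (ContinuousLinearMap.id ℝ (F →L[ℝ] G))
          (bilinear hr (ContinuousLinearMap.id ℝ (F →L[ℝ] F →L[ℝ] G))
            (compLeft hr Q hQ ⟨fun x => (u x, h x), P h⟩) h) h‖
        ≤ K₁ * ‖bilinear hr (ContinuousLinearMap.id ℝ (F →L[ℝ] F →L[ℝ] G))
            (compLeft hr Q hQ ⟨fun x => (u x, h x), P h⟩) h‖ * ‖h‖ := by
          rw [hK₁]
          exact norm_bilinear_le hr _ _ _
      _ ≤ K₁ * (K₂ * ‖compLeft hr Q hQ ⟨fun x => (u x, h x), P h⟩‖ * ‖h‖) * ‖h‖ := by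
          gcongr
          rw [hK₂]
          exact norm_bilinear_le hr _ _ _
      _ ≤ K₁ * (K₂ * M * ‖h‖) * ‖h‖ := by
          gcongr
          exact hM _ hprod
      _ = K₁ * (K₂ * M) * ‖h‖ ^ 2 := by ring
  exact hbig.trans_isLittleO (isLittleO_norm_pow_id one_lt_two)

/-- **`C^n` regularity of the Nemytskii operator for every `n : ℕ`** (induction on `n`, for all
complete targets `G` and all smooth `φ` at once: the derivative `u ↦ (Dφ ∘ u) · (·)` is the
bounded bilinear pairing `bilinearCLM` after the Nemytskii operator of `Dφ : F → (F →L G)`).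
[folklore] -/
theorem contDiff_nat_compLeft (hr : r ≤ 1) {k : ℕ} :
    ∀ (n : ℕ) {G : Type u} [NormedAddCommGroup G] [NormedSpace ℝ G] [CompleteSpace G]
      (φ : F → G) (hφ : ContDiff ℝ ∞ φ),
      ContDiff ℝ n (fun u : ContDiffHolderFunction E F k r =>
        compLeft hr φ (hφ.of_le (by exact_mod_cast le_top)) u) := by
  intro n
  induction n with
  | zero =>
    intro G _ _ _ φ hφ
    rw [Nat.cast_zero, contDiff_zero]
    exact continuous_iff_continuousAt.2 fun u => (hasFDerivAt_compLeft hr φ hφ u).continuousAt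
  | succ n ih =>
    intro G _ _ _ φ hφ
    rw [Nat.cast_succ, contDiff_succ_iff_hasFDerivAt]
    refine ⟨_, ?_, hasFDerivAt_compLeft hr φ hφ⟩
    exact (bilinearCLM hr (ContinuousLinearMap.id ℝ (F →L[ℝ] G))).contDiff.comp
      (ih (fderiv ℝ φ) (hφ.fderiv_right (m := ∞) le_rfl))

end Nemytskii

/-! ### The main theorem -/

/-- **The Nemytskii (superposition) operator is smooth on `C^{k,r}_b`.** For `0 ≤ r ≤ 1`, a
finite-dimensional `F`, a complete `G` and a smooth `φ : F → G`, the map `u ↦ φ ∘ u` is `C^∞`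
from the Banach space `C^{k,r}_b(E, F)` to `C^{k,r}_b(E, G)`, and its Fréchet derivative at `u`
is `h ↦ (x ↦ Dφ(u x) (h x))`, i.e. the pairing of `Dφ ∘ u ∈ C^{k,r}_b(E, F →L G)` with `h`
(Gilbarg–Trudinger 2001, §4.1: Hölder classes are stable under smooth maps of the values, with
the chain rule). [cite: GilbargTrudinger2001, §4.1] -/
theorem contDiff_compLeft {E F G : Type} [NormedAddCommGroup E] [NormedSpace ℝ E]
    [NormedAddCommGroup F] [NormedSpace ℝ F] [FiniteDimensional ℝ F]
    [NormedAddCommGroup G] [NormedSpace ℝ G] [CompleteSpace G]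
    {k : ℕ} {r : ℝ≥0} (hr : r ≤ 1) (φ : F → G) (hφ : ContDiff ℝ ∞ φ) :
    ContDiff ℝ ∞ (fun u : ContDiffHolderFunction E F k r =>
      ContDiffHolderFunction.compLeft hr φ (hφ.of_le (by exact_mod_cast le_top)) u) ∧
    ∀ u : ContDiffHolderFunction E F k r,
      HasFDerivAt (fun u : ContDiffHolderFunction E F k r =>
          ContDiffHolderFunction.compLeft hr φ (hφ.of_le (by exact_mod_cast le_top)) u)
        (ContDiffHolderFunction.bilinearCLM hr (ContinuousLinearMap.id ℝ (F →L[ℝ] G))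
          (ContDiffHolderFunction.compLeft hr (fderiv ℝ φ)
            ((hφ.fderiv_right (m := ∞) le_rfl).of_le (by exact_mod_cast le_top)) u)) u :=
  ⟨contDiff_infty.2 fun n => contDiff_nat_compLeft hr n φ hφ,
    fun u => hasFDerivAt_compLeft hr φ hφ u⟩

end ContDiffHolderFunction

end Literature.Analysis.FunctionSpaces

end
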